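import Summits.BirchSwinnertonDyer.Rank1Residual.Additive.KroneckerTwistCoeff
import Summits.BirchSwinnertonDyer.Rank1Residual.Additive.SemistableTwistAnalytic
import Literature.NumberTheory.EllipticCurves.QuadraticTwistKroneckerRootNumberProofs
import Literature.NumberTheory.EllipticCurves.CyclotomicIwasawaMainTheoremIrreducibleBaseChangeProofs
import Literature.NumberTheory.EllipticCurves.ModularSymbolsHeckeProofs
import Literature.NumberTheory.EllipticCurves.PAdicLFunctionNeZeroHoldsProofs
import Literature.NumberTheory.QuadraticFields.KroneckerSplitting
import Literature.NumberTheory.QuadraticFields.FundamentalDiscriminant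
import Literature.NumberTheory.EllipticCurves.HeegnerPoints
import Literature.NumberTheory.EllipticCurves.ModularityVersionApProofs
import Literature.NumberTheory.EllipticCurves.SzpiroOfAbcProofs
import HarnessLib

/-!
# STEP C(3b) of the kernel derivation of `hFact`: the twist data attached to a Heegner field
# (cell `bsd-addord`, seat `bsd-addord-gz` gen 4)

HONEST FRAMING (cell `bsd-addord`; PARTITION (D-0054): EXCLUDED-DOMAIN additive rows §E, B6 = O7-ord r1 ×
every consumer of hFact — types-the-object-of; booked 0). THEOREMS ONLY. For `E = W` additive at
`p ≡ 1 (mod 4)`, `W ≅ V ⊗ χ_p` with `V` good ordinary (newform `f`), and a quadratic field `K` in which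
every prime of `N_E` splits (Heegner hypothesis), this file supplies the inputs of STEP C(2)
(`branchPAdicGrossZagier_identity_of_cycLine`) that are THEOREMS: `p ∤ d_K`, `(d_K/p) = 1`, good
reduction of `V` and `W` at the primes of `d_K` (`N_E = N_V·p²`), a globally minimal good ordinary model
`V′` of `V ⊗ κ_K` with its newform `f′`, `a_n(f′) = κ_K(n)a_n(f)`, `a_p(V′) = a_p(V)`
(`exists_twist_newform`), and `∑(a/p)[a/p]⁺_{f′} ≠ 0` from `L(E^{(d_K)}, 1) ≠ 0` (Birch's formula and the
identity theorem; `legendrePlusSymbolSum_ne_zero_of_twist`). Named facts displayed: modularity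
(`hmodD`, `hmodN`, `hmod`).

References: [SilvermanAEC2009] X.2 Prop. 2.4, Ex. 10.16; [Cox2013] Lemma 1.14; [MazurTateTeitelbaum1986Invent]
§I.8 (8.6); [Knapp1993] Prop. 12.10; [GrossZagier1986] §I (Heegner hypothesis).
-/

set_option autoImplicit false

noncomputable section

open scoped Classical MatrixGroups ModularForm NumberField NumberTheorySymbols

open CongruenceSubgroup WeierstrassCurve NumberField IsDedekindDomain Rat.HeightOneSpectrum
  Literature.NumberTheory.EllipticCurves Literature.NumberTheory.EllipticCurves.ModularForms
  Literature.NumberTheory.EllipticCurves.Rank1Residual Literature.NumberTheory.QuadraticFields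
  Literature.NumberTheory.QuadraticFields.Quadratic

namespace Summit.BirchSwinnertonDyer.Rank1Residual.Additive

section Heegner

variable (K : Type) [Field K] [NumberField K]

/-- **Ramified primes do not split**: under the Heegner hypothesis for `N`, no prime dividing `d_K`
divides `N`. [cite: GrossZagier1986, §I.1 (Heegner hypothesis)] [cite: Cox2013, §1.C Lemma 1.14] -/
theorem not_dvd_of_heegner_of_dvd_discr (h2 : Module.finrank ℚ K = 2) {N : ℕ}
    (hH : SatisfiesHeegnerHypothesis N K) {ℓ : ℕ} (hℓ : ℓ.Prime) (hℓd : (ℓ : ℤ) ∣ NumberField.discr K) :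
    ¬ ℓ ∣ N := by
  intro hℓN
  have hsplit := hH ℓ hℓ hℓN
  by_cases hℓ2 : ℓ = 2
  · subst hℓ2
    rw [Nat.cast_ofNat, ncard_primesOver_two_eq_two_iff h2] at hsplit
    obtain ⟨k, hk⟩ := hℓd
    omega
  · rw [ncard_primesOver_eq_two_iff_jacobiSym h2 hℓ hℓ2, jacobiSym.mod_left,
      Int.emod_eq_zero_of_dvd hℓd, jacobiSym.zero_left hℓ.one_lt] at hsplit
    exact zero_ne_one hsplit

/-- **A prime of the level splits: `(d_K/p) = 1` and `p ∤ d_K`** (odd `p ∣ N`, Heegner hypothesis for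
`N`). [cite: GrossZagier1986, §I.1 (Heegner hypothesis)] [cite: Cox2013, §1.C Lemma 1.14] -/
theorem jacobiSym_eq_one_of_heegner (h2 : Module.finrank ℚ K = 2) {N : ℕ}
    (hH : SatisfiesHeegnerHypothesis N K) {p : ℕ} (hp : p.Prime) (hp2 : p ≠ 2) (hpN : p ∣ N) :
    jacobiSym (NumberField.discr K) p = 1 ∧ ¬ (p : ℤ) ∣ NumberField.discr K := by
  have h1 := (ncard_primesOver_eq_two_iff_jacobiSym h2 hp hp2).mp (hH p hp hpN)
  refine ⟨h1, fun hpd ↦ ?_⟩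
  rw [jacobiSym.mod_left, Int.emod_eq_zero_of_dvd hpd, jacobiSym.zero_left hp.one_lt] at h1
  exact zero_ne_one h1

/-- Good reduction at the primes of `d_K` from the Heegner hypothesis for the conductor.
[cite: GrossZagier1986, §I.1 (Heegner hypothesis)] -/
theorem hasGoodReductionAt_of_heegner_of_dvd_discr (h2 : Module.finrank ℚ K = 2)
    (X : WeierstrassCurve ℚ) [X.IsElliptic] (hH : SatisfiesHeegnerHypothesis (X.conductorNorm ℤ) K)
    (v : HeightOneSpectrum (𝓞 ℚ)) (hv : ((primesEquiv v : ℕ) : ℤ) ∣ NumberField.discr K) :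
    X.HasGoodReductionAt v :=
  hasGoodReductionAt_of_not_dvd_conductorNorm X v
    (not_dvd_of_heegner_of_dvd_discr K h2 hH (primesEquiv v).2 hv)

end Heegner

section Twist

variable {W : WeierstrassCurve ℚ} [W.IsElliptic] [W.IsGloballyMinimal] {p : ℕ} [hp : Fact p.Prime]
  (K : Type) [Field K] [NumberField K]

omit [W.IsElliptic] [W.IsGloballyMinimal] in
/-- **`N_E = N_V · p²`** for the additive curve `E = W ≅ V ⊗ χ_p` (`p ≡ 1 (mod 4)`, `V` good at `p`):
the conductor of the twist by the fundamental discriminant `p` prime to `N_V` (tree theorem from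
modularity `hmodN`). [cite: DiamondShurman2005, §8.3] -/
theorem conductorNorm_eq_of_good_twist (hmodN : exists_isNewformOf) (hp4 : p % 4 = 1)
    (V : WeierstrassCurve ℚ) [V.IsElliptic] [V.IsGloballyMinimal]
    (hVW : ∃ C : VariableChange ℚ, C • V.quadraticTwist (p : ℚ) = W)
    (hgood : V.HasGoodReductionAtPrime p) : W.conductorNorm ℤ = V.conductorNorm ℤ * p ^ 2 := by
  have hpP : p.Prime := hp.out
  obtain ⟨C, hC⟩ := hVW
  have hD4 : ((p : ℤ)) % 4 = 1 := by omega
  have hsq : Squarefree (p : ℤ) := (Nat.prime_iff_prime_int.mp hpP).squarefree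
  have hgcd : Int.gcd (p : ℤ) (V.conductorNorm ℤ) = 1 := by
    rw [Int.gcd_natCast_natCast]
    refine (Nat.Prime.coprime_iff_not_dvd hpP).mpr fun h ↦ ?_
    exact (V.dvd_conductorNorm_iff_not_hasGoodReductionAtPrime p).mp h hgood
  have h := V.conductorNorm_quadraticTwist_of_emod_four_eq_one hmodN hD4 hsq hgcd
  rw [Int.natAbs_natCast, Int.cast_natCast] at h
  haveI := V.isElliptic_quadraticTwist (d := (p : ℚ)) (by exact_mod_cast hpP.ne_zero)
  rw [← hC, conductorNorm_smul_rat, h]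

omit [W.IsGloballyMinimal] in
/-- **The twist data attached to a Heegner field.** `E = W` additive at `p ≡ 1 (mod 4)`, `W ≅ V ⊗ χ_p`
with `V` good ordinary (newform `f`), `K` quadratic with the Heegner hypothesis for `N_E`, `κ` its
Kronecker character carrying the twist coefficients (`exists_kroneckerChar_twistCoeff`). Then there are a
globally minimal good ordinary `V′ ≅ V ⊗ κ` with newform `f′`, `a_n(f′) = κ(n)·a_n(f)`,
`a_p(V′) = a_p(V)`; moreover `p ∤ d_K` and `a_n(E^{(d_K)}) = κ(n)·a_n(E)`.
[cite: SilvermanAEC2009, X.2 Prop. 2.4 and Exercise 10.16] [cite: Knapp1993, Prop. 12.10]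
[cite: Cox2013, §1.C Lemma 1.14] -/
theorem exists_twist_newform (hmodD : nonempty_modularParametrizationData) (hmodN : exists_isNewformOf)
    (hp4 : p % 4 = 1) (h2 : Module.finrank ℚ K = 2) (κ : DirichletCharacter ℂ (NumberField.discr K).natAbs)
    (hκ : ∀ ℓ : ℕ, ℓ.Prime → ℓ ≠ 2 → κ ℓ = (jacobiSym (NumberField.discr K) ℓ : ℂ))
    (hκall : ∀ (X : WeierstrassCurve ℚ) [X.IsElliptic],
      (∀ v : HeightOneSpectrum (𝓞 ℚ), ((primesEquiv v : ℕ) : ℤ) ∣ NumberField.discr K →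
        X.HasGoodReductionAt v) →
      ∀ n : ℕ, (((X.quadraticTwist (NumberField.discr K : ℚ)).LFunction n : ℤ) : ℂ) =
        κ n * ((X.LFunction n : ℤ) : ℂ))
    (hH : SatisfiesHeegnerHypothesis (W.conductorNorm ℤ) K) (hadd : Addv W p)
    (V : WeierstrassCurve ℚ) [V.IsElliptic] [V.IsGloballyMinimal]
    (hVW : ∃ C : VariableChange ℚ, C • V.quadraticTwist (p : ℚ) = W) (hord : GoodOrd V p)
    {N : ℕ} [NeZero N] {f : CuspForm (Gamma0 N) 2} (hf : IsNewformOf V f) :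
    ¬ (p : ℤ) ∣ NumberField.discr K ∧
    (∀ n : ℕ, (((W.quadraticTwist (NumberField.discr K : ℚ)).LFunction n : ℤ) : ℂ) =
      κ n * ((W.LFunction n : ℤ) : ℂ)) ∧
    ∃ (V' : WeierstrassCurve ℚ) (_ : V'.IsElliptic) (_ : V'.IsGloballyMinimal) (N' : ℕ) (_ : NeZero N')
      (f' : CuspForm (Gamma0 N') 2), IsNewformOf V' f' ∧
      (∀ n : ℕ, cuspCoeff f' n = κ (n : ZMod (NumberField.discr K).natAbs) * cuspCoeff f n) ∧
      V'.frobeniusTrace p = V.frobeniusTrace p ∧ IsOrdinaryAt V' p := by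
  have hpP : p.Prime := hp.out
  have hp2 : p ≠ 2 := by omega
  have hd0 : NumberField.discr K ≠ 0 := NumberField.discr_ne_zero K
  have hdq : (NumberField.discr K : ℚ) ≠ 0 := by exact_mod_cast hd0
  -- `p` splits in `K`
  have hpN : p ∣ W.conductorNorm ℤ :=
    (W.dvd_conductorNorm_iff_not_hasGoodReductionAtPrime p).mpr hadd.1
  obtain ⟨hjp, hpd⟩ := jacobiSym_eq_one_of_heegner K h2 hH hpP hp2 hpN
  have hκp : κ (p : ZMod (NumberField.discr K).natAbs) = 1 := by rw [hκ p hpP hp2, hjp, Int.cast_one]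
  -- good reduction of `V` and `W` at the primes of `d_K`
  have hNW : W.conductorNorm ℤ = V.conductorNorm ℤ * p ^ 2 :=
    conductorNorm_eq_of_good_twist hmodN hp4 V hVW hord.1
  have hHV : SatisfiesHeegnerHypothesis (V.conductorNorm ℤ) K := hH.of_dvd ⟨p ^ 2, hNW⟩
  have hgoodV := hasGoodReductionAt_of_heegner_of_dvd_discr K h2 V hHV
  have hgoodW := hasGoodReductionAt_of_heegner_of_dvd_discr K h2 W hH
  refine ⟨hpd, hκall W hgoodW, ?_⟩
  -- the minimal model of the twist and its newform
  obtain ⟨V', iE, iM, C', hC'⟩ := exists_isGloballyMinimal_smul_eq_quadraticTwist V hdq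
  haveI : NeZero (V'.conductorNorm ℤ) := ⟨(V'.conductorNorm_pos_holds).ne'⟩
  obtain ⟨Dm'⟩ := hmodD V'
  have hLV' : ∀ n : ℕ, V'.LFunction n = (V.quadraticTwist (NumberField.discr K : ℚ)).LFunction n :=
    fun n ↦ by rw [← hC', LFunction_smul]
  have hV' : ∀ n : ℕ, cuspCoeff Dm'.f n = κ (n : ZMod (NumberField.discr K).natAbs) * cuspCoeff f n :=
      fun n ↦ by
    rw [Dm'.isNewformOf.2 n, hf.2 n, hLV' n]
    exact hκall V hgoodV n
  -- `V'` is good ordinary at `p`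
  have hordin : IsOrdinaryAt V p := ⟨hord.1, hord.2⟩
  have hordV' : IsOrdinaryAt V' p := by
    rcases isFundamentalDiscriminant_discr (K := K) h2 with ⟨-, hsq, -⟩ | ⟨h4, -, hsq⟩
    · exact isOrdinaryAt_of_smul_eq_quadraticTwist V V' hsq hC' p hp2 hpd hordin
    · obtain ⟨m, hm⟩ := h4
      have hDm : NumberField.discr K / 4 = m := by rw [hm, Int.mul_ediv_cancel_left _ four_ne_zero]
      rw [hDm] at hsq
      obtain ⟨C₂, hC₂⟩ := V.exists_variableChange_quadraticTwist_mul_sq (m : ℚ) 2 two_ne_zero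
      have hdm : ((m : ℚ) * 2 ^ 2) = (NumberField.discr K : ℚ) := by rw [hm]; push_cast; ring
      rw [hdm] at hC₂
      have hC'' : (C₂⁻¹ * C') • V' = V.quadraticTwist (m : ℚ) := by
        rw [mul_smul, hC', ← hC₂, inv_smul_smul]
      have hpm : ¬ (p : ℤ) ∣ m := fun h ↦ hpd (by rw [hm]; exact h.mul_left 4)
      exact isOrdinaryAt_of_smul_eq_quadraticTwist V V' hsq hC'' p hp2 hpm hordin
  -- `a_p(V′) = a_p(V)`
  have hap : V'.frobeniusTrace p = V.frobeniusTrace p := by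
    have e : ((V'.LFunction p : ℤ) : ℂ) = ((V.LFunction p : ℤ) : ℂ) := by
      rw [hLV' p, hκall V hgoodV p, hκp, one_mul]
    have e' : V'.LFunction p = V.LFunction p := by exact_mod_cast e
    rw [← V'.LFunction_apply_prime_eq_frobeniusTrace p hordV'.1,
      ← V.LFunction_apply_prime_eq_frobeniusTrace p hord.1, e']
  exact ⟨V', iE, iM, V'.conductorNorm ℤ, inferInstance, Dm'.f, Dm'.isNewformOf, hV', hap, hordV'⟩

omit [W.IsGloballyMinimal] in
/-- **`∑(a/p)[a/p]⁺_{f′} ≠ 0` from `L(E^{(d_K)}, 1) ≠ 0`.** The coefficients of `E^{(d_K)}` are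
`κ(n)·(n/p)·a_n(f) = (n/p)·a_n(f′)`, so `L(E^{(d_K)}, s)` continues `L(f′, χ_p, s)` and Birch's formula
`∑(a/p)[a/p]⁺_{f′}·Ω⁺_{f′} = τ(χ_p)·L(f′, χ_p, 1)` (tree theorem) makes the sum non-zero.
[cite: MazurTateTeitelbaum1986Invent, §I.8 (8.6)] [cite: SilvermanAEC2009, C.16] -/
theorem legendrePlusSymbolSum_ne_zero_of_twist (hmod : hasEntireLFunction_rat) (hp4 : p % 4 = 1)
    (κ : DirichletCharacter ℂ (NumberField.discr K).natAbs)
    (hκW : ∀ n : ℕ, (((W.quadraticTwist (NumberField.discr K : ℚ)).LFunction n : ℤ) : ℂ) =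
      κ n * ((W.LFunction n : ℤ) : ℂ))
    (hadd : Addv W p) (V : WeierstrassCurve ℚ) [V.IsElliptic] [V.IsGloballyMinimal]
    (hVW : ∃ C : VariableChange ℚ, C • V.quadraticTwist (p : ℚ) = W)
    {N N' : ℕ} [NeZero N] [NeZero N'] {f : CuspForm (Gamma0 N) 2} {f' : CuspForm (Gamma0 N') 2}
    (hf : IsNewformOf V f) (hf' : IsNewform0 f') (hQ' : coeffField f' = ⊥)
    (hV' : ∀ n : ℕ, cuspCoeff f' n = κ (n : ZMod (NumberField.discr K).natAbs) * cuspCoeff f n)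
    (hLd : (W.quadraticTwist (NumberField.discr K : ℚ)).entireLFunction 1 ≠ 0) :
    legendrePlusSymbolSum f' p ≠ 0 := by
  haveI : NeZero p := ⟨hp.out.ne_zero⟩
  have hpP : p.Prime := hp.out
  have hp2 : p ≠ 2 := by omega
  have hdq : (NumberField.discr K : ℚ) ≠ 0 := by exact_mod_cast NumberField.discr_ne_zero K
  haveI := W.isElliptic_quadraticTwist hdq
  set Wd := W.quadraticTwist (NumberField.discr K : ℚ) with hWd
  have hEnt : Wd.HasEntireLFunction := hmod Wd
  obtain ⟨hχ1, hχq, hχprim⟩ := jacobiChar_prime_ne_one_isQuadratic_isPrimitive p hp2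
  have hχe := jacobiChar_even_of_mod_four_eq_one p hp4
  set χ := jacobiChar p with hχdef
  -- the coefficients of `E^{(d_K)}` are those of `f' ⊗ χ_p`
  have hco : ∀ n : ℕ, ((Wd.LFunction n : ℤ) : ℂ) = χ n * cuspCoeff f' n := by
    intro n
    rw [hWd, hκW n, hV' n, intCast_LFunction_eq_jacobiChar_mul_cuspCoeff p hp4 V W hVW hadd hf n]
    ring
  obtain ⟨L₂, hL₂d, hL₂⟩ := exists_differentiable_eq_twistedLSeries_holds f' χ
  -- identity theorem: `L(E^{(d_K)}, s) = L₂(s)`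
  have heq : Wd.entireLFunction = L₂ := by
    refine AnalyticOnNhd.eq_of_eventuallyEq (z₀ := (3 : ℂ))
      ((Wd.differentiable_entireLFunction hEnt).differentiableOn.analyticOnNhd isOpen_univ)
      (hL₂d.differentiableOn.analyticOnNhd isOpen_univ) ?_
    have hopen : IsOpen {s : ℂ | (2 : ℝ) < s.re} := isOpen_lt continuous_const Complex.continuous_re
    filter_upwards [hopen.mem_nhds (show (2 : ℝ) < (3 : ℂ).re by norm_num)] with s hs
    have hs' : (2 : ℝ) < s.re := hs
    rw [Wd.entireLFunction_eq_LSeries hEnt (by linarith), LSeries_eq_twistedLSeries_of_coeff Wd f' χ hco,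
      hL₂ s hs']
  have hL₂1 : L₂ 1 ≠ 0 := by rw [← heq]; exact hLd
  -- Birch's formula for `f'` at `χ_p`
  have hBirch := ratTwistedSymbolSum_mul_plusPeriod_holds hf' hQ' hχprim hχe hL₂d
    (fun s hs ↦ by rw [hχq.inv]; exact hL₂ s hs)
  rw [← cast_legendrePlusSymbolSum_eq_ratTwistedSymbolSum p f'] at hBirch
  have hτ : gaussSum χ (ZMod.stdAddChar (N := p)) ≠ 0 := by
    intro h
    have hsq := gaussSum_sq hχ1 hχq (ZMod.isPrimitive_stdAddChar p)
    rw [h, hχe, one_mul, ZMod.card, zero_pow two_ne_zero] at hsq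
    exact (Nat.cast_ne_zero.mpr hpP.ne_zero) hsq.symm
  intro hS
  rw [hS, Rat.cast_zero, zero_mul] at hBirch
  exact mul_ne_zero hτ hL₂1 hBirch.symm

end Twist

end Summit.BirchSwinnertonDyer.Rank1Residual.Additive

end
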